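import Summits.FinalStateConjecture.FinalStateConjecture.Theses.PhaseMixingCapture

/-!
# `NonlinearKappaUpgrade` (item stmt-FinalStateConjecture-14714, route `PhaseMixingCapture`):
# logical position of the glue `KappaExplicitWaveDecay → NearExtremalKappaCapture`

The support item `NonlinearKappaUpgrade` of route `PhaseMixingCapture` is, by `Iff.rfl`, the
implication `K → N` between two cruxes of the same route: `K = KappaExplicitWaveDecay` (rank 3,
κ-explicit boundedness + integrated local energy decay for scalar waves on the whole sub-extremal
Kerr range) and `N = NearExtremalKappaCapture` (rank 2, near-extremal nonlinear capture with
κ-power basin and modulus). This file records, sorry-free and without introducing any definition,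
where the item sits logically:

* §1 read-back (`nonlinearKappaUpgrade_iff`);
* §2 the glue is a COROLLARY of crux `N` (`nonlinearKappaUpgrade_of_near`), it feeds `closes` as
  intended (`near_of_nonlinearKappaUpgrade`), granted `K` it IS `N`
  (`nonlinearKappaUpgrade_iff_near_of_kappa`), granted `¬N` it is `¬K` — the route's kill-criteria
  fork (`nonlinearKappaUpgrade_iff_not_kappa_of_not_near`); classically `K → N ↔ N ∨ ¬K`, and a
  refutation of the glue must prove `K` AND refute `N` (`not_nonlinearKappaUpgrade_iff`);
* §3 the hypothesis `K` is dischargeable in the wave-free fragment: if every admissible wave on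
  every sub-extremal Kerr exterior vanishes identically, `K` holds with `(p, j, C) = (0, 0, 0)`
  (`kappaExplicitWaveDecay_of_forall_wave_eq_zero`), so any proof of the glue proves the crux `N`
  outright in that fragment (`near_of_nonlinearKappaUpgrade_of_forall_wave_eq_zero`). At present
  the tree PROVES the existence of no nonzero admissible Kerr wave (the Cauchy theory for `□_g` on
  Kerr–Schild backgrounds is vendored only as the unproved named fact
  `KerrSchild.waveCauchyProblem`), so a proof of the glue from tree theorems cannot extract anything
  from `K` that is not already a proof of `N`; and even granted that fact there is no bridge in the
  tree from scalar-wave energies on exact Kerr to `VacuumCauchyDevelopment` / `ConvergesToKerr`.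

Pure logic plus `sliceEnergy U 0 τ = 0`; no named fact is used.
-/

noncomputable section

set_option linter.dupNamespace false

namespace Summit.FinalStateConjecture.FinalStateConjecture.Theorems.NonlinearKappaUpgrade

open Summit.FinalStateConjecture.FinalStateConjecture.Theses.PhaseMixingCapture
open Literature.Geometry.Lorentzian
open scoped Manifold ENNReal Topology ContDiff
open Filter Set MeasureTheory

/-! ## §1 Read-back -/

/-- READ-BACK: the glue item is literally the implication between the two cruxes. -/
theorem nonlinearKappaUpgrade_iff :
    NonlinearKappaUpgrade ↔ (KappaExplicitWaveDecay → NearExtremalKappaCapture) :=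
  Iff.rfl

/-! ## §2 Position in the route's logic -/

/-- The glue is a corollary of the crux it feeds: `N → (K → N)`. (So the item closes the moment
crux `NearExtremalKappaCapture` does, by `glue_by` with this theorem.) -/
theorem nonlinearKappaUpgrade_of_near (hN : NearExtremalKappaCapture) : NonlinearKappaUpgrade :=
  fun _ ↦ hN

/-- Intended use in the deciding theorem: `closes (hUp hK) hBulk hWCC hSuff`. -/
theorem near_of_nonlinearKappaUpgrade (hUp : NonlinearKappaUpgrade) (hK : KappaExplicitWaveDecay) :
    NearExtremalKappaCapture :=
  hUp hK

/-- Granted the linear floor `K`, the glue IS the nonlinear crux `N`. -/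
theorem nonlinearKappaUpgrade_iff_near_of_kappa (hK : KappaExplicitWaveDecay) :
    NonlinearKappaUpgrade ↔ NearExtremalKappaCapture :=
  ⟨fun hUp ↦ hUp hK, fun hN _ ↦ hN⟩

/-- The route's kill-criteria fork: if the nonlinear crux `N` is refuted, the glue is exactly the
NEGATION of the linear crux `K` ("the obstruction is nonlinear" ↔ the glue fails). -/
theorem nonlinearKappaUpgrade_iff_not_kappa_of_not_near (hN : ¬ NearExtremalKappaCapture) :
    NonlinearKappaUpgrade ↔ ¬ KappaExplicitWaveDecay :=
  ⟨fun hUp hK ↦ hN (hUp hK), fun hK' hK ↦ (hK' hK).elim⟩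

/-- Classically the glue is the disjunction `N ∨ ¬K`: it carries no content beyond the two cruxes
it connects. -/
theorem nonlinearKappaUpgrade_iff_near_or_not_kappa :
    NonlinearKappaUpgrade ↔ (NearExtremalKappaCapture ∨ ¬ KappaExplicitWaveDecay) := by
  rw [nonlinearKappaUpgrade_iff]
  tauto

/-- SHAPE OF A REFUTATION: `¬ (K → N)` is `K ∧ ¬N` — a refuter of the glue must PROVE the linear
crux and REFUTE the nonlinear one. -/
theorem not_nonlinearKappaUpgrade_iff :
    ¬ NonlinearKappaUpgrade ↔ (KappaExplicitWaveDecay ∧ ¬ NearExtremalKappaCapture) := by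
  rw [nonlinearKappaUpgrade_iff]
  tauto

/-! ## §3 The hypothesis is idle in the wave-free fragment -/

/-- The zero-extension of the zero scalar field is the zero function on `E4`. [folklore] -/
theorem extend_zero (U : TopologicalSpace.Opens E4) :
    Function.extend Subtype.val (0 : U → ℝ) (0 : E4 → ℝ) = 0 := by
  funext x
  by_cases hx : ∃ y : U, (y : E4) = x
  · obtain ⟨y, rfl⟩ := hx
    exact Subtype.val_injective.extend_apply _ _ y
  · exact Function.extend_apply' _ _ _ hx

/-- The coordinate energy density of the zero field vanishes. [folklore] -/
theorem coordEnergyDensity_zero (U : TopologicalSpace.Opens E4) (x : E4) :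
    coordEnergyDensity U (0 : U → ℝ) x = 0 := by
  simp [coordEnergyDensity, extend_zero]

/-- The slice energy of the zero field vanishes. [folklore] -/
theorem sliceEnergy_zero (U : TopologicalSpace.Opens E4) (τ : ℝ) :
    sliceEnergy U (0 : U → ℝ) τ = 0 := by
  simp [sliceEnergy, coordEnergyDensity_zero]

/-- The local slice energy of the zero field vanishes. [folklore] -/
theorem localSliceEnergy_zero (U : TopologicalSpace.Opens E4) (τ R : ℝ) :
    localSliceEnergy U (0 : U → ℝ) τ R = 0 :=
  le_antisymm ((localSliceEnergy_le_sliceEnergy U 0 τ R).trans_eq (sliceEnergy_zero U τ))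
    bot_le

/-- **`K` holds in the wave-free fragment.** If every admissible wave (smooth solution of
`□_g ψ = 0` on the sub-extremal Kerr exterior `{r > r₊}`, `M > 0`, whose data vanish off a compact
subset of the leaf `{t* = 0}`) vanishes identically, then `KappaExplicitWaveDecay` holds, with
`p = 0`, `j = 0` and constant `C = 0` in both conjuncts: both sides of every estimate are `0`.
The tree proves the existence of no nonzero admissible wave (well-posedness of `□_g` on Kerr is the
unproved named fact `KerrSchild.waveCauchyProblem`), so this hypothesis is not refutable from tree
theorems today; it isolates exactly what the glue's hypothesis can contribute. -/
theorem kappaExplicitWaveDecay_of_forall_wave_eq_zero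
    (h0 : ∀ [Kerr.Facts] [Kerr.SliceFacts] (M a : ℝ), 0 < M → Kerr.IsSubextremal M a →
      ∀ ψ : Kerr.exterior M a → ℝ, ContMDiff 𝓘(ℝ, E4) 𝓘(ℝ, ℝ) ∞ ψ →
        (∀ x, (Kerr.smoothMetric M a (Kerr.rPlus M a)).toPseudoRiemannianMetric.dalembertian ψ x
          = 0) →
        (∃ K : Set (Kerr.exterior M a), IsCompact K ∧ ∀ x : Kerr.exterior M a, (x : E4) 0 = 0 →
          x ∉ K → ψ x = 0 ∧ mfderiv 𝓘(ℝ, E4) 𝓘(ℝ, ℝ) ψ x = 0) →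
        ψ = 0) :
    KappaExplicitWaveDecay := by
  intro _ _ M hM
  refine ⟨0, 0, ⟨0, ENNReal.zero_lt_top, ?_⟩, fun R ↦ ⟨0, ENNReal.zero_lt_top, ?_⟩⟩
  · intro a ha ψ hψ τ _
    obtain rfl : ψ = 0 := h0 M a hM ha ψ hψ.1 hψ.2.1 hψ.2.2
    rw [sliceEnergy_zero]
    exact bot_le
  · intro a ha ψ hψ
    obtain rfl : ψ = 0 := h0 M a hM ha ψ hψ.1 hψ.2.1 hψ.2.2
    simp only [localSliceEnergy_zero, lintegral_zero]
    exact bot_le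

/-- **The glue proves the crux in the wave-free fragment.** Any proof of `NonlinearKappaUpgrade`
yields `NearExtremalKappaCapture` outright as soon as every admissible Kerr wave is zero — a
hypothesis consistent with every theorem of the present tree, which constructs none: the item is
crux-complete for `NearExtremalKappaCapture` (stmt-FinalStateConjecture-10606). -/
theorem near_of_nonlinearKappaUpgrade_of_forall_wave_eq_zero (hUp : NonlinearKappaUpgrade)
    (h0 : ∀ [Kerr.Facts] [Kerr.SliceFacts] (M a : ℝ), 0 < M → Kerr.IsSubextremal M a →
      ∀ ψ : Kerr.exterior M a → ℝ, ContMDiff 𝓘(ℝ, E4) 𝓘(ℝ, ℝ) ∞ ψ →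
        (∀ x, (Kerr.smoothMetric M a (Kerr.rPlus M a)).toPseudoRiemannianMetric.dalembertian ψ x
          = 0) →
        (∃ K : Set (Kerr.exterior M a), IsCompact K ∧ ∀ x : Kerr.exterior M a, (x : E4) 0 = 0 →
          x ∉ K → ψ x = 0 ∧ mfderiv 𝓘(ℝ, E4) 𝓘(ℝ, ℝ) ψ x = 0) →
        ψ = 0) :
    NearExtremalKappaCapture :=
  hUp (kappaExplicitWaveDecay_of_forall_wave_eq_zero h0)

end Summit.FinalStateConjecture.FinalStateConjecture.Theorems.NonlinearKappaUpgrade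

end
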